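import Summits.AtomisticToContinuum.HydrodynamicLimit.Theorems.CollisionIsometryCLTCollisionalTransferLocalityEnergyAllTimes
import Summits.AtomisticToContinuum.HydrodynamicLimit.Theorems.JParityClosureOddContactSymmetryGibbsInvariance
import Literature.MathematicalPhysics.KineticTheory.CollisionTubeDensityWeight
import Literature.MathematicalPhysics.KineticTheory.HardSphereDisplacementPathLength
import HarnessLib

/-!
# [MC] The all-times ceiling of the mollified density at equilibrium (stub `stub_mollifiedCeilingConst`)
(line `hemisphere-affine-slaving`, crux `CollisionalTransferLocality`, stmt-AtomisticToContinuum-9518)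

Supporting file (`--supports stmt-AtomisticToContinuum-9518`) of the line lead, proving the registered
stub [MC] `stub_mollifiedCeilingConst` VERBATIM: at global equilibrium (homogeneous local Gibbs law
`G_N = localGibbsLaw σ 1 0 θ N (Φ N)`, `θ > 0`, `σ` small), for EVERY flow family `Φ`, every horizon
`t > 0` and every FIXED radius `0 < r < 1/4`, the event "the cone-mollified empirical density
`ρ_r(Φ_s z, x)` exceeds `2` at some `s ∈ [0, t]` and some `x ∈ 𝕋³`" has `G_N`-probability `→ 0`.

## Proof

* Static step at ONE time `s` (`tendsto_localGibbsLaw_exists_mollDensity_gt`): the event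
  `{∃ x, 3/2 < ρ_r(Φ_s z, x)}` is contained in `Φ_s⁻¹ (pos⁻¹ S_N)`,
  `S_N = {p | ∃ y, 1/2 ≤ |ρ̃_r(p, y) − 1|}` (`mollDensity_eq_empDensity`), a CLOSED position event
  (`continuous_empDensity`, `𝕋³` compact: `isClosedMap_fst_of_compactSpace`).  Stationarity of the
  homogeneous law (`measurePreserving_flow_localGibbsLaw_const`) removes `Φ_s`, the position marginal
  is the canonical gas (`localGibbsLaw_eq`, `localGibbsMeasure_preimage_pos`), and the uniform density
  LLN `tendsto_posGibbs_exists_density_dev` (`δ = 1/2`, `r < 1/2`) gives `→ 0`.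
* Pathwise time modulus (`abs_mollDensity_flow_sub_le`): on a good orbit with `E(z) ≤ K (N+1)`,
  `|ρ_r(Φ_s z, x) − ρ_r(Φ_{s'} z, x)| ≤ (3/(π r⁴)) |s − s'| √(2K)` — the cone kernel is symmetric and
  `3/(π r⁴)`-Lipschitz (`abs_coneKernel_sub_le`), displacements are bounded by path lengths
  (`HardSphereFlow.euclidDist_flow_le_integral_norm_vel`), and Cauchy–Schwarz of the summed speeds
  against the conserved energy (`∑ᵢ ‖vᵢ(u)‖ ≤ (N+1) √(2K)`).
* Energy: `stub_energyAllTimes` at the constant profiles gives `E₀ ≥ 0` with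
  `G_N {∃ s ∈ [0,t], E₀ < (N+1)⁻¹ E(Φ_s z)} → 0`; off this event `E(z) ≤ E₀ (N+1)` (`flow_zero`).
* Grid: mesh `w = t/(n+1)` with `(3/(π r⁴)) √(2E₀) w ≤ 1/2`; a value `> 2` at `s ∈ [kw, (k+1)w)`
  forces `> 3/2` at the grid time `kw`, `k ≤ n + 1`.  Union bound over the null complement of the
  good set (`localGibbsMeasure_absolutelyContinuous`, `HardSphereFlow.measure_compl_good`), the energy
  event and the `n + 2` grid events (`tendsto_finsetSum`), then squeeze.

No new definitions, no named facts; axioms `propext`, `Classical.choice`, `Quot.sound`.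
-/

namespace Summit.AtomisticToContinuum.HydrodynamicLimit.Theorems.HemisphereAffineSlaving

open scoped BigOperators Topology Classical ENNReal
open Filter Set Function MeasureTheory

noncomputable section

open Literature.MathematicalPhysics.KineticTheory (T3 V3)
open Literature.MathematicalPhysics.KineticTheory Literature.Analysis.FluidPDE

/-! ## Two measure-theoretic trivialities -/

/-- Monotonicity of a measure along an inclusion that holds on a conull set `g`:
if `μ gᶜ = 0` and `s ∩ g ⊆ t`, then `μ s ≤ μ t`. -/
-- adapted from …Theorems/CollisionIsometryCLTCollisionalTransferLocalityEnergyAllTimes.lean (private)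
private theorem mc_measure_le_of_subset_on {α : Type*} [MeasurableSpace α] {μ : Measure α}
    {g s t : Set α} (hg : μ gᶜ = 0) (h : ∀ x ∈ g, x ∈ s → x ∈ t) : μ s ≤ μ t :=
  calc μ s ≤ μ (gᶜ ∪ t) := measure_mono fun x hx => by
          by_cases hxg : x ∈ g
          · exact Or.inr (h x hxg hx)
          · exact Or.inl hxg
    _ ≤ μ gᶜ + μ t := measure_union_le _ _
    _ = μ t := by rw [hg, zero_add]

/-- The static position event `{p | ∃ y, δ ≤ |ρ̃_r(p, y) − 1|}` is closed (joint continuity of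
`ρ̃_r`, compactness of `𝕋³`: the first projection is a closed map), hence measurable. -/
private theorem mc_measurableSet_exists_density_dev (n : ℕ) (r δ : ℝ) :
    MeasurableSet {p : Fin n → T3 | ∃ y : T3, δ ≤ |empDensity r p y - 1|} := by
  have hF : IsClosed {q : (Fin n → T3) × T3 | δ ≤ |empDensity r q.1 q.2 - 1|} :=
    isClosed_le continuous_const ((continuous_empDensity r).sub continuous_const).abs
  have himg : Prod.fst '' {q : (Fin n → T3) × T3 | δ ≤ |empDensity r q.1 q.2 - 1|} =
      {p : Fin n → T3 | ∃ y : T3, δ ≤ |empDensity r p y - 1|} := by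
    ext p
    constructor
    · rintro ⟨q, hq, rfl⟩
      exact ⟨q.2, hq⟩
    · rintro ⟨y, hy⟩
      exact ⟨(p, y), hy, rfl⟩
  rw [← himg]
  exact (isClosedMap_fst_of_compactSpace _ hF).measurableSet

/-! ## The pathwise time modulus of the mollified density on a capped good orbit -/

/-- Pointwise Cauchy–Schwarz on the speeds along a good orbit: if `E(z) ≤ K n` then
`∑ᵢ ‖vᵢ(u)‖ ≤ n √(2K)` at every time `u` (`(∑ᵢ ‖vᵢ‖)² ≤ n ∑ᵢ ‖vᵢ‖² = 2 n E(Φ_u z) = 2 n E(z)`). -/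
-- adapted from …Theorems/StiffCollisionalRelaxationAprioriBoundsBlockModulus.lean (private there)
private theorem mc_sum_norm_vel_flow_le {d : Type*} [Fintype d] {ε : ℝ} {n : ℕ}
    (Φ : HardSphereFlow (Torus.geometry d) ε n) {z : Config n d (UnitAddTorus d)} (hz : z ∈ Φ.good)
    {K : ℝ} (hK : 0 ≤ K) (hE : configEnergy z ≤ K * n) (u : ℝ) :
    ∑ i, ‖(Φ.flow u z i).2‖ ≤ n * Real.sqrt (2 * K) := by
  have hsq : (∑ i, ‖(Φ.flow u z i).2‖) ^ 2 ≤ (n * Real.sqrt (2 * K)) ^ 2 := by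
    calc (∑ i, ‖(Φ.flow u z i).2‖) ^ 2
        ≤ (Finset.univ : Finset (Fin n)).card * ∑ i, ‖(Φ.flow u z i).2‖ ^ 2 :=
          sq_sum_le_card_mul_sum_sq
      _ = n * (2 * configEnergy (Φ.flow u z)) := by
          rw [Finset.card_univ, Fintype.card_fin]
          simp only [configEnergy]
          ring
      _ = n * (2 * configEnergy z) := by rw [Φ.configEnergy_flow hz u]
      _ ≤ n * (2 * (K * n)) := by gcongr
      _ = (n * Real.sqrt (2 * K)) ^ 2 := by
          rw [mul_pow, Real.sq_sqrt (by positivity)]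
          ring
  exact le_of_sq_le_sq hsq (by positivity)

/-- Sum of the displacements over `[t₁, t₂]` along a good orbit whose total speed `∑ᵢ ‖vᵢ(u)‖` is
bounded by `M` at all times: `∑ᵢ dist_{T^d}(xᵢ(t₂), xᵢ(t₁)) ≤ M (t₂ − t₁)` (path-length bound,
summed, and `∑ᵢ ∫ = ∫ ∑ᵢ`). -/
-- adapted from …Theorems/StiffCollisionalRelaxationAprioriBoundsBlockModulus.lean (private there)
private theorem mc_sum_euclidDist_flow_le {d : Type*} [Fintype d] {ε : ℝ} {n : ℕ}
    (Φ : HardSphereFlow (Torus.geometry d) ε n) {z : Config n d (UnitAddTorus d)} (hz : z ∈ Φ.good)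
    {M : ℝ} (hM : ∀ u, ∑ i, ‖(Φ.flow u z i).2‖ ≤ M) {t₁ t₂ : ℝ} (h12 : t₁ ≤ t₂) :
    ∑ i, Torus.euclidDist (Φ.flow t₂ z i).1 (Φ.flow t₁ z i).1 ≤ M * (t₂ - t₁) := by
  have hint : ∀ i ∈ (Finset.univ : Finset (Fin n)),
      IntervalIntegrable (fun u => ‖(Φ.flow u z i).2‖) volume t₁ t₂ :=
    fun i _ => Φ.intervalIntegrable_norm_vel_flow hz i t₁ t₂
  have hsum : IntervalIntegrable (fun u => ∑ i, ‖(Φ.flow u z i).2‖) volume t₁ t₂ := by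
    have h := IntervalIntegrable.sum Finset.univ hint
    rwa [Finset.sum_fn] at h
  calc ∑ i, Torus.euclidDist (Φ.flow t₂ z i).1 (Φ.flow t₁ z i).1
      ≤ ∑ i, ∫ u in t₁..t₂, ‖(Φ.flow u z i).2‖ :=
        Finset.sum_le_sum fun i _ => Φ.euclidDist_flow_le_integral_norm_vel hz i h12
    _ = ∫ u in t₁..t₂, ∑ i, ‖(Φ.flow u z i).2‖ := (intervalIntegral.integral_finsetSum hint).symm
    _ ≤ ∫ u in t₁..t₂, M :=
        intervalIntegral.integral_mono_on h12 hsum intervalIntegrable_const fun u _ => hM u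
    _ = M * (t₂ - t₁) := by rw [intervalIntegral.integral_const, smul_eq_mul, mul_comm]

/-- The cone kernel is symmetric in its two points (the minimal-image distance is). -/
private theorem mc_coneKernel_comm (r : ℝ) (x y : T3) : coneKernel r x y = coneKernel r y x := by
  unfold coneKernel
  rw [Torus.euclidDist_comm]

/-- **Pathwise time modulus of the mollified density on a capped good orbit.**  On a good orbit of the
hard-sphere flow of `N + 1` spheres on `𝕋³` with `E(z) ≤ K (N+1)`, for `r > 0`, all times `s, s'` and
every centre `x`,
`|ρ_r(Φ_s z, x) − ρ_r(Φ_{s'} z, x)| ≤ (3/(π r⁴)) · |s − s'| √(2K)`: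
the cone kernel is `3/(π r⁴)`-Lipschitz in the particle position (`abs_coneKernel_sub_le` and symmetry),
each displacement is bounded by the path length (`HardSphereFlow.euclidDist_flow_le_integral_norm_vel`),
and the summed speeds are `≤ (N+1) √(2K)` by Cauchy–Schwarz against the conserved energy. -/
theorem abs_mollDensity_flow_sub_le {σ : ℝ} {N : ℕ}
    (Φ : HardSphereFlow (Torus.geometry (Fin 3)) (hsDiameter σ N) (N + 1))
    {z : Config (N + 1) (Fin 3) T3} (hz : z ∈ Φ.good) {K : ℝ} (hK : 0 ≤ K)
    (hE : configEnergy z ≤ K * ((N : ℝ) + 1)) {r : ℝ} (hr : 0 < r) (s s' : ℝ) (x : T3) :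
    |mollDensity r (Φ.flow s z) x - mollDensity r (Φ.flow s' z) x| ≤
      3 / (Real.pi * r ^ 4) * (|s - s'| * Real.sqrt (2 * K)) := by
  have hn0 : (0 : ℝ) < (N : ℝ) + 1 := by positivity
  have hcast : ((N + 1 : ℕ) : ℝ) = (N : ℝ) + 1 := by push_cast; rfl
  have hL0 : 0 ≤ 3 / (Real.pi * r ^ 4) := by positivity
  -- (1) the summed displacements: `∑ᵢ dist(xᵢ(s), xᵢ(s')) ≤ (N+1) |s − s'| √(2K)`
  have hM : ∀ u, ∑ i, ‖(Φ.flow u z i).2‖ ≤ ((N + 1 : ℕ) : ℝ) * Real.sqrt (2 * K) :=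
    mc_sum_norm_vel_flow_le Φ hz hK (by rw [hcast]; exact hE)
  have hsumD : ∑ i, Torus.euclidDist (Φ.flow s z i).1 (Φ.flow s' z i).1 ≤
      ((N : ℝ) + 1) * (|s - s'| * Real.sqrt (2 * K)) := by
    rcases le_total s' s with h | h
    · calc ∑ i, Torus.euclidDist (Φ.flow s z i).1 (Φ.flow s' z i).1
          ≤ ((N + 1 : ℕ) : ℝ) * Real.sqrt (2 * K) * (s - s') := mc_sum_euclidDist_flow_le Φ hz hM h
        _ = ((N : ℝ) + 1) * (|s - s'| * Real.sqrt (2 * K)) := by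
            rw [hcast, abs_of_nonneg (sub_nonneg.2 h)]
            ring
    · calc ∑ i, Torus.euclidDist (Φ.flow s z i).1 (Φ.flow s' z i).1
          = ∑ i, Torus.euclidDist (Φ.flow s' z i).1 (Φ.flow s z i).1 :=
            Finset.sum_congr rfl fun i _ => Torus.euclidDist_comm _ _
        _ ≤ ((N + 1 : ℕ) : ℝ) * Real.sqrt (2 * K) * (s' - s) := mc_sum_euclidDist_flow_le Φ hz hM h
        _ = ((N : ℝ) + 1) * (|s - s'| * Real.sqrt (2 * K)) := by
            rw [hcast, abs_sub_comm, abs_of_nonneg (sub_nonneg.2 h)]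
            ring
  -- (2) the kernel increment of one particle (symmetry + Lipschitz in the second slot)
  have hterm : ∀ i, |coneKernel r (Φ.flow s z i).1 x - coneKernel r (Φ.flow s' z i).1 x| ≤
      3 / (Real.pi * r ^ 4) * Torus.euclidDist (Φ.flow s z i).1 (Φ.flow s' z i).1 := by
    intro i
    rw [mc_coneKernel_comm r _ x, mc_coneKernel_comm r _ x]
    exact abs_coneKernel_sub_le hr x _ _
  -- (3) average over the particles
  simp only [mollDensity_eq_empDensity, empDensity]
  rw [hcast, ← mul_sub, ← Finset.sum_sub_distrib, abs_mul, abs_of_pos (inv_pos.2 hn0),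
    inv_mul_le_iff₀ hn0]
  calc |∑ i, (coneKernel r (Φ.flow s z i).1 x - coneKernel r (Φ.flow s' z i).1 x)|
      ≤ ∑ i, |coneKernel r (Φ.flow s z i).1 x - coneKernel r (Φ.flow s' z i).1 x| :=
        Finset.abs_sum_le_sum_abs _ _
    _ ≤ ∑ i, 3 / (Real.pi * r ^ 4) * Torus.euclidDist (Φ.flow s z i).1 (Φ.flow s' z i).1 :=
        Finset.sum_le_sum fun i _ => hterm i
    _ = 3 / (Real.pi * r ^ 4) * ∑ i, Torus.euclidDist (Φ.flow s z i).1 (Φ.flow s' z i).1 := by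
        rw [← Finset.mul_sum]
    _ ≤ 3 / (Real.pi * r ^ 4) * (((N : ℝ) + 1) * (|s - s'| * Real.sqrt (2 * K))) :=
        mul_le_mul_of_nonneg_left hsumD hL0
    _ = ((N : ℝ) + 1) * (3 / (Real.pi * r ^ 4) * (|s - s'| * Real.sqrt (2 * K))) := by ring

/-! ## The static step, moved to a fixed time by stationarity -/

/-- **One-time bound at equilibrium.**  At small reduced density (`SmallDensity uniformProfile σ`),
`θ > 0`, `0 < r < 1/2`, for every flow family `Φ` and every FIXED time `s`,
`G_N {z | ∃ x, 3/2 < ρ_r(Φ_s z, x)} → 0`: the event lies in `Φ_s⁻¹ (pos⁻¹ S_N)` with the closed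
position event `S_N = {p | ∃ y, 1/2 ≤ |ρ̃_r(p, y) − 1|}` (`mollDensity_eq_empDensity`); stationarity
(`measurePreserving_flow_localGibbsLaw_const`) removes `Φ_s`, the position marginal of `G_N` is the
canonical gas (`localGibbsMeasure_preimage_pos`), and the uniform density LLN
`tendsto_posGibbs_exists_density_dev` concludes. -/
theorem tendsto_localGibbsLaw_exists_mollDensity_gt {σ θ : ℝ} (hS : SmallDensity uniformProfile σ)
    (hθ : 0 < θ) (Φ : Flows σ) {r : ℝ} (hr : 0 < r) (hr2 : r < 1 / 2) (s : ℝ) :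
    Tendsto (fun N : ℕ => localGibbsLaw σ (fun _ => 1) (fun _ => 0) (fun _ => θ) N (Φ N)
      {z | ∃ x : T3, 3 / 2 < mollDensity r ((Φ N).flow s z) x}) atTop (𝓝 0) := by
  refine tendsto_of_tendsto_of_tendsto_of_le_of_le tendsto_const_nhds
    (tendsto_posGibbs_exists_density_dev hS one_pos hr hr2 (δ := 1 / 2) (by norm_num))
    (fun _ => zero_le) fun N => ?_
  have hSm : MeasurableSet {p : Fin (N + 1) → T3 | ∃ y : T3, 1 / 2 ≤ |empDensity r p y - 1|} :=
    mc_measurableSet_exists_density_dev (N + 1) r (1 / 2)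
  -- the event is contained in the pull-back of the static position event
  have hsub : {z : Cfg N | ∃ x : T3, 3 / 2 < mollDensity r ((Φ N).flow s z) x} ⊆
      (Φ N).flow s ⁻¹' ((fun (z : Cfg N) (i : Fin (N + 1)) => (z i).1) ⁻¹'
        {p : Fin (N + 1) → T3 | ∃ y : T3, 1 / 2 ≤ |empDensity r p y - 1|}) := by
    rintro z ⟨x, hx⟩
    rw [mem_preimage, mem_preimage, mem_setOf_eq]
    refine ⟨x, ?_⟩
    rw [mollDensity_eq_empDensity] at hx
    have h' : (1 / 2 : ℝ) ≤ empDensity r (fun m => ((Φ N).flow s z m).1) x - 1 := by linarith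
    exact h'.trans (le_abs_self _)
  have hinv := measurePreserving_flow_localGibbsLaw_const σ 1 θ 0 N (Φ N) s
  calc localGibbsLaw σ (fun _ => 1) (fun _ => 0) (fun _ => θ) N (Φ N)
        {z | ∃ x : T3, 3 / 2 < mollDensity r ((Φ N).flow s z) x}
      ≤ localGibbsLaw σ (fun _ => 1) (fun _ => 0) (fun _ => θ) N (Φ N)
          ((Φ N).flow s ⁻¹' ((fun (z : Cfg N) (i : Fin (N + 1)) => (z i).1) ⁻¹'
            {p : Fin (N + 1) → T3 | ∃ y : T3, 1 / 2 ≤ |empDensity r p y - 1|})) :=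
        measure_mono hsub
    _ ≤ localGibbsLaw σ (fun _ => 1) (fun _ => 0) (fun _ => θ) N (Φ N)
          ((fun (z : Cfg N) (i : Fin (N + 1)) => (z i).1) ⁻¹'
            {p : Fin (N + 1) → T3 | ∃ y : T3, 1 / 2 ≤ |empDensity r p y - 1|}) :=
        hinv.measure_preimage_le _
    _ = posGibbsMeasure (fun _ => (1 : ℝ)) (hsDiameter σ N) (N + 1)
          {p : Fin (N + 1) → T3 | ∃ y : T3, 1 / 2 ≤ |empDensity r p y - 1|} := by
        rw [localGibbsLaw_eq]
        exact localGibbsMeasure_preimage_pos (a₀ := fun _ => (1 : ℝ)) (θ₀ := fun _ => θ)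
          (u₀ := fun _ => (0 : V3)) continuous_const continuous_const continuous_const
          (fun _ => zero_le_one) (fun _ => hθ) σ N hSm

/-! ## Assembly: the registered stub -/

/-- **[MC] ALL-TIMES CEILING OF THE MOLLIFIED DENSITY AT EQUILIBRIUM** (registered stub
`stub_mollifiedCeilingConst` of the line `hemisphere-affine-slaving`, crux `CollisionalTransferLocality`):
for every temperature `θ > 0` there is `σ₀ > 0` (the uniform-profile smallness threshold
`exists_smallDensity`) such that for `0 < σ < σ₀`, EVERY flow family `Φ`, every horizon `t > 0` and
every fixed radius `0 < r < 1/4`, under the homogeneous local Gibbs law `G_N = localGibbsLaw σ 1 0 θ N (Φ N)`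
the event "`ρ_r(Φ_s z, x) > 2` for some `s ∈ [0, t]`, `x ∈ 𝕋³`" has probability `→ 0`.
Proof: energy cap `E(z) ≤ E₀ (N+1)` w.h.p. (`stub_energyAllTimes`, conservation), pathwise time
modulus `(3/(π r⁴)) √(2E₀) |s − s'|` of `ρ_r` on capped good orbits (`abs_mollDensity_flow_sub_le`),
a FIXED grid of mesh `w` with `(3/(π r⁴)) √(2E₀) w ≤ 1/2` reducing `> 2` somewhere to `> 3/2` at a grid
time, the one-time bound `tendsto_localGibbsLaw_exists_mollDensity_gt` at each of the `n + 2` grid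
times, and a union bound (the law is carried by the good set). -/
theorem stub_mollifiedCeilingConst : ∀ θ : ℝ, 0 < θ → ∃ σ₀ : ℝ, 0 < σ₀ ∧ ∀ σ : ℝ, 0 < σ → σ < σ₀ → ∀ (Φ : Flows σ) (t r : ℝ), 0 < t → 0 < r → r < 1 / 4 → Tendsto (fun N : ℕ => Literature.MathematicalPhysics.KineticTheory.localGibbsLaw σ (fun _ => 1) (fun _ => 0) (fun _ => θ) N (Φ N) {z | ∃ s ∈ Icc 0 t, ∃ x : T3, 2 < Literature.MathematicalPhysics.KineticTheory.mollDensity r ((Φ N).flow s z) x}) atTop (𝓝 0) := by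
  intro θ hθ
  obtain ⟨σ₀, hσ₀, hsmall⟩ := exists_smallDensity uniformProfile one_pos
  refine ⟨σ₀, hσ₀, fun σ hσ hσσ₀ Φ t r ht hr hr4 => ?_⟩
  have hS : SmallDensity uniformProfile σ := (hsmall σ hσ hσσ₀).1
  have hr2 : r < 1 / 2 := by linarith
  -- the energy cap of the line ([E], `stub_energyAllTimes`) at the constant profiles
  obtain ⟨E₀, hE₀, hEt⟩ := stub_energyAllTimes (fun _ => 1) (fun _ => θ) (fun _ => 0)
    ⟨continuous_const, continuous_const, continuous_const, fun _ => one_pos, fun _ => hθ⟩ σ hσ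
    hS.σ_lt_half.le Φ
  -- the Lipschitz constant in time and the grid
  set L : ℝ := 3 / (Real.pi * r ^ 4) * Real.sqrt (2 * E₀) with hL
  have hL0 : 0 ≤ L := by positivity
  obtain ⟨n, hn⟩ := exists_nat_ge (2 * L * t)
  have hn1 : (0 : ℝ) < (n : ℝ) + 1 := by positivity
  set w : ℝ := t / ((n : ℝ) + 1) with hw
  have hw0 : 0 < w := div_pos ht hn1
  have htw : ((n : ℝ) + 1) * w = t := by rw [hw]; field_simp
  have hLw : L * w ≤ 1 / 2 := by
    rw [hw, mul_div_assoc', div_le_iff₀ hn1]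
    linarith
  -- abbreviations: the laws, the grid events, the energy event
  set P : (N : ℕ) → Measure (Cfg N) :=
    fun N => localGibbsLaw σ (fun _ => 1) (fun _ => 0) (fun _ => θ) N (Φ N) with hP
  set A : (N : ℕ) → ℕ → Set (Cfg N) :=
    fun N k => {z | ∃ x : T3, 3 / 2 < mollDensity r ((Φ N).flow ((k : ℝ) * w) z) x} with hA
  set B : (N : ℕ) → Set (Cfg N) :=
    fun N => {z | ∃ s ∈ Icc 0 t, E₀ < ((N : ℝ) + 1)⁻¹ * configEnergy ((Φ N).flow s z)} with hB
  -- the union bound, for every `N`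
  have hbound : ∀ N : ℕ, P N {z | ∃ s ∈ Icc 0 t, ∃ x : T3, 2 < mollDensity r ((Φ N).flow s z) x} ≤
      P N (B N) + ∑ k ∈ Finset.range (n + 2), P N (A N k) := by
    intro N
    have hN1 : (0 : ℝ) < (N : ℝ) + 1 := by positivity
    -- `P_N` is carried by the good set
    have hg : P N (Φ N).goodᶜ = 0 := by
      show localGibbsLaw σ (fun _ => 1) (fun _ => 0) (fun _ => θ) N (Φ N) (Φ N).goodᶜ = 0
      rw [localGibbsLaw_eq]
      exact localGibbsMeasure_absolutelyContinuous σ _ _ _ N (Φ N) (Φ N).measure_compl_good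
    calc P N {z | ∃ s ∈ Icc 0 t, ∃ x : T3, 2 < mollDensity r ((Φ N).flow s z) x}
        ≤ P N (B N ∪ ⋃ k ∈ Finset.range (n + 2), A N k) := by
          refine mc_measure_le_of_subset_on hg fun z hz hbad => ?_
          simp only [mem_setOf_eq] at hbad
          obtain ⟨s, hs, x, hx⟩ := hbad
          by_cases hzB : z ∈ B N
          · exact Or.inl hzB
          refine Or.inr (mem_iUnion₂.2 ?_)
          -- the energy cap at time `0`
          have hE : configEnergy z ≤ E₀ * ((N : ℝ) + 1) := by
            have h0 : ((N : ℝ) + 1)⁻¹ * configEnergy ((Φ N).flow 0 z) ≤ E₀ :=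
              not_lt.1 fun h' => hzB ⟨0, ⟨le_rfl, ht.le⟩, h'⟩
            rw [(Φ N).flow_zero z hz, inv_mul_le_iff₀ hN1] at h0
            linarith
          -- the grid index `k = ⌊s/w⌋`
          obtain ⟨k, hks, hsk⟩ : ∃ k : ℕ, (k : ℝ) * w ≤ s ∧ s < ((k : ℝ) + 1) * w := by
            refine ⟨⌊s / w⌋₊, ?_, ?_⟩
            · have h1 := Nat.floor_le (div_nonneg hs.1 hw0.le)
              rwa [le_div_iff₀ hw0] at h1
            · have h1 := Nat.lt_floor_add_one (s / w)
              rwa [div_lt_iff₀ hw0] at h1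
          have hkn : k < n + 2 := by
            have h1 : (k : ℝ) * w ≤ ((n : ℝ) + 1) * w := by rw [htw]; exact hks.trans hs.2
            have h2 : (k : ℝ) ≤ (n : ℝ) + 1 := le_of_mul_le_mul_right h1 hw0
            have h3 : k ≤ n + 1 := by exact_mod_cast h2
            omega
          refine ⟨k, Finset.mem_range.2 hkn, ?_⟩
          -- the time modulus between `s` and the grid time `k w`
          have hmod := abs_mollDensity_flow_sub_le (Φ N) hz hE₀ hE hr s ((k : ℝ) * w) x
          have hdiff : |s - (k : ℝ) * w| * Real.sqrt (2 * E₀) ≤ w * Real.sqrt (2 * E₀) := by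
            refine mul_le_mul_of_nonneg_right ?_ (Real.sqrt_nonneg _)
            rw [abs_of_nonneg (by linarith)]
            linarith
          have hhalf : |mollDensity r ((Φ N).flow s z) x - mollDensity r ((Φ N).flow ((k : ℝ) * w) z) x| ≤
              1 / 2 :=
            calc |mollDensity r ((Φ N).flow s z) x - mollDensity r ((Φ N).flow ((k : ℝ) * w) z) x|
                ≤ 3 / (Real.pi * r ^ 4) * (|s - (k : ℝ) * w| * Real.sqrt (2 * E₀)) := hmod
              _ ≤ 3 / (Real.pi * r ^ 4) * (w * Real.sqrt (2 * E₀)) :=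
                  mul_le_mul_of_nonneg_left hdiff (by positivity)
              _ = L * w := by rw [hL]; ring
              _ ≤ 1 / 2 := hLw
          have hlow := (abs_sub_le_iff.1 hhalf).1
          exact ⟨x, by linarith⟩
      _ ≤ P N (B N) + P N (⋃ k ∈ Finset.range (n + 2), A N k) := measure_union_le _ _
      _ ≤ P N (B N) + ∑ k ∈ Finset.range (n + 2), P N (A N k) :=
          add_le_add le_rfl (measure_biUnion_finset_le _ _)
  -- the limits of the bounding events
  have hlim : Tendsto (fun N : ℕ => P N (B N) + ∑ k ∈ Finset.range (n + 2), P N (A N k)) atTop (𝓝 0) := by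
    have h1 : Tendsto (fun N : ℕ => P N (B N)) atTop (𝓝 0) := hEt t
    have h2 : Tendsto (fun N : ℕ => ∑ k ∈ Finset.range (n + 2), P N (A N k)) atTop (𝓝 0) := by
      have h := tendsto_finsetSum (Finset.range (n + 2))
        (fun k _ => tendsto_localGibbsLaw_exists_mollDensity_gt hS hθ Φ hr hr2 ((k : ℝ) * w))
      rwa [Finset.sum_const_zero] at h
    have h12 := h1.add h2
    rwa [add_zero] at h12
  exact tendsto_of_tendsto_of_tendsto_of_le_of_le tendsto_const_nhds hlim (fun _ => zero_le) hbound

end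

end Summit.AtomisticToContinuum.HydrodynamicLimit.Theorems.HemisphereAffineSlaving
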